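import Literature.Computability.Cryptography.KitaevBlockEmbedded
import Literature.Computability.Cryptography.ShiftModes
import Literature.Computability.QuantumComplexity.SandwichBlock
import HarnessLib

/-!
# Kitaev's block measuring the cyclic shift: the mode moves on and the controls factorise

Topic `Literature/Computability/Cryptography`; support for the discharge of
`VanDamSeroussi2002_gaussSumPhase_qsolvable`; sequel of `KitaevBlockEmbedded.lean` (the block
`H_controls; V; S³_σ; H_controls` on embedded controls and its action on superpositions,
`KitaevEmb.block_mulVec_superposition`) and `ShiftModes.lean` (the modes `ψ_u` of the cyclic shift on
`[0, M)` and the kick-back `ψ_u((x − b) mod M) = e(ub/M) ψ_u(x)`, `Kitaev.mode_shift`). Kitaev 1995,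
§3 Lemma 10 / §5: the classical block of the eigenvalue measurement of the shift applies, controlled by
the control bits `y`, the shift by `sh(y) = Σ_j y_j w_j` — in the tree's van Dam–Seroussi circuit an
IN-PLACE addition, realised garbage-free by writing `(x + sh(y)) mod M` into a fresh register and
clearing the old one (two oracle-answered XOR blocks). This file proves the algebra of that situation
(no circuit here: the block enters through its action `A` on labels):

* `KitaevShift.sh w y = Σ_j y_j w_j`, `sum_range_mode_smul_comp_shift` — moving a register in mode `u`
  by `s` (mod `M`) is multiplying it by `e(us/M)` (re-indexing `Hales2002.sum_range_comp_add_mod` and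
  `Kitaev.mode_shift`);
* **`KitaevShift.mode_factorisation`** — if `A` moves the content `x < M` of the register `asE`,
  shifted by `sh(y)`, to the register `asE2` (labels `writeNat` on lists of wires,
  controls rewritten by `writeB cw`), then the block's output on `Σ_{x<M} ψ_u(x) |x on asE⟩` is the SAME
  mode on `asE2` tensored with the control amplitudes `Kitaev1995.modeAmp σ w M u` of
  `KitaevModePhaseEstimation.lean` — whose Born weights are the independent Hadamard tests of the
  eigenphase `u/M` (`norm_sq_modeAmp`): the eigenvalue measurement LEARNS the mode index and leaves the
  mode intact for later kick-backs.

Everything is proved; the one definition has a body; no named fact.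

## References

* A. Yu. Kitaev, arXiv:quant-ph/9511026 (1995), §3 (Lemma 8, Lemma 10), §5 [Kitaev1995].
* W. van Dam, G. Seroussi, arXiv:quant-ph/0207131 (2002), §3 Lemma 1, §4 [VanDamSeroussi2002].
-/

noncomputable section

open Finset Matrix Complex

namespace Literature.Computability.Cryptography

namespace KitaevShift

open Literature.Computability.QuantumComplexity Literature.Computability.QuantumComplexity.QFTQubits Kitaev1995 Kitaev Hales2002

variable {N k : ℕ}

/-- **The shift applied by the controls**: `sh(y) = Σ_j y_j w_j` (control `j` applies the `w_j`-th
power of the shift). [cite: Kitaev1995, §3 Lemma 10 (the operator U^{[0,r]})] -/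
def sh (w : Fin k → ℕ) (y : Fin k → Bool) : ℕ := ∑ j, (y j).toNat * w j

/-- **Moving a register in mode `u` by `s` multiplies it by `e(us/M)`**: for any coefficients `F` on
the labels, `Σ_{x<M} ψ_u(x) F((x + s) mod M) = e(us/M) Σ_{x<M} ψ_u(x) F(x)`. [cite: Kitaev1995, §5] -/
theorem sum_range_mode_smul_comp_shift {V : Type*} [AddCommGroup V] [Module ℂ V] {M : ℕ} (hM : 0 < M) (u s : ℕ)
    (F : ℕ → V) :
    ∑ x ∈ range M, mode M u x • F ((x + s) % M) = e (((u * s : ℕ) : ℝ) / M) • ∑ x ∈ range M, mode M u x • F x := by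
  -- `ψ_u(x) = e(us/M) ψ_u((x + s) mod M)` for `x < M`
  have key : ∀ x ∈ range M, mode M u x = e (((u * s : ℕ) : ℝ) / M) * mode M u ((x + s) % M) := by
    intro x hx
    have hx' := mem_range.1 hx
    have hlt : (x + s) % M < M := Nat.mod_lt _ hM
    have h := mode_shift hM u s hlt
    have hback : ((x + s) % M + M - s % M) % M = x := by
      set r := (x + s) % M with hr
      have hsle : s % M ≤ r + M := by have := Nat.mod_lt s hM; omega
      have hchain : (r + M - s % M) + s % M ≡ x + s % M [MOD M] := by
        rw [Nat.sub_add_cancel hsle]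
        calc r + M ≡ r [MOD M] := Nat.add_mod_right r M
          _ ≡ x + s [MOD M] := by rw [hr]; exact Nat.mod_modEq _ _
          _ ≡ x + s % M [MOD M] := Nat.ModEq.add_left x (Nat.mod_modEq s M).symm
      have h := Nat.ModEq.add_right_cancel' (s % M) hchain
      rw [Nat.ModEq, Nat.mod_eq_of_lt hx'] at h
      exact h
    rw [hback] at h
    exact h
  rw [Finset.smul_sum]
  calc ∑ x ∈ range M, mode M u x • F ((x + s) % M)
      = ∑ x ∈ range M, e (((u * s : ℕ) : ℝ) / M) • (mode M u ((x + s) % M) • F ((x + s) % M)) := by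
        refine sum_congr rfl fun x hx => ?_
        rw [key x hx, smul_smul]
    _ = ∑ x ∈ range M, e (((u * s : ℕ) : ℝ) / M) • (mode M u x • F x) :=
        sum_range_comp_add_mod M (fun x => e (((u * s : ℕ) : ℝ) / M) • (mode M u x • F x)) s

/-- The control amplitude of `KitaevModePhaseEstimation` in terms of `sh` and `e`. [folklore] -/
theorem modeAmp_eq (σ : Fin k → Bool) (w : Fin k → ℕ) (M u : ℕ) (γ : Fin k → Bool) :
    modeAmp σ w M u γ = (1 / 2 : ℂ) ^ k * ∑ y : Fin k → Bool, sPhase σ y * ySign y γ * e (((u * sh w y : ℕ) : ℝ) / M) := by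
  unfold modeAmp sh
  congr 1
  refine sum_congr rfl fun y _ => ?_
  rw [e_eq_cexp]
  congr 2
  push_cast
  ring

/-- **The mode factorisation of the shift block.** Controls `cw`, register wires `asE`, `asE2`; the
classical block acts on the label "`x` on `asE`, controls `y`" (any `x < M`) as
`A (base[asE ↦ x][cw ↦ y]) = base[asE2 ↦ (x + sh(y)) mod M][cw ↦ y]`. Then the double sum produced by
`KitaevEmb.block_mulVec_superposition` on the input `Σ_{x<M} ψ_u(x) |base[asE ↦ x]⟩` collapses to
`Σ_{x<M} ψ_u(x) Σ_{γ} modeAmp σ w M u γ • |base[asE2 ↦ x][cw ↦ γ]⟩`: the mode reappears unchanged on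
the new register, the controls carry `modeAmp`. [cite: Kitaev1995, §3 Lemma 10 and §5] -/
theorem mode_factorisation (cw : Fin k ↪ Fin N) (asE asE2 : List (Fin N)) (σ : Fin k → Bool) (w : Fin k → ℕ)
    {M : ℕ} (hM : 0 < M) (u : ℕ) (A : QReg N → QReg N) (base : QReg N)
    (hA : ∀ x, x < M → ∀ y : Fin k → Bool,
      A (writeB cw (writeNat asE base x) y) = writeB cw (writeNat asE2 base ((x + sh w y) % M)) y) :
    ∑ x ∈ range M, mode M u x • ((invSqrt2 ^ k * invSqrt2 ^ k) •
        ∑ y : Fin k → Bool, ∑ y' : Fin k → Bool, (sPhase σ y * ySign y y') •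
          basisState (writeB cw (A (writeB cw (writeNat asE base x) y)) y')) =
      ∑ x ∈ range M, mode M u x • ∑ γ : Fin k → Bool, modeAmp σ w M u γ •
        basisState (writeB cw (writeNat asE2 base x) γ) := by
  -- rewrite the block's action and collapse the double control rewrite
  have hlab : ∀ x ∈ range M, ∀ y y' : Fin k → Bool,
      writeB cw (A (writeB cw (writeNat asE base x) y)) y' =
        writeB cw (writeNat asE2 base ((x + sh w y) % M)) y' := by
    intro x hx y y'
    rw [hA x (mem_range.1 hx) y, KitaevEmb.writeB_writeB']
  calc ∑ x ∈ range M, mode M u x • ((invSqrt2 ^ k * invSqrt2 ^ k) •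
        ∑ y : Fin k → Bool, ∑ y' : Fin k → Bool, (sPhase σ y * ySign y y') •
          basisState (writeB cw (A (writeB cw (writeNat asE base x) y)) y'))
      = ∑ x ∈ range M, mode M u x • ((invSqrt2 ^ k * invSqrt2 ^ k) •
          ∑ y' : Fin k → Bool, ∑ y : Fin k → Bool, (sPhase σ y * ySign y y') •
            basisState (writeB cw (writeNat asE2 base ((x + sh w y) % M)) y')) := by
        refine sum_congr rfl fun x hx => ?_
        rw [Finset.sum_comm]
        congr 2
        refine sum_congr rfl fun y' _ => sum_congr rfl fun y _ => ?_
        rw [hlab x hx y y']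
    _ = (invSqrt2 ^ k * invSqrt2 ^ k) • ∑ y' : Fin k → Bool, ∑ y : Fin k → Bool, (sPhase σ y * ySign y y') •
          ∑ x ∈ range M, mode M u x • basisState (writeB cw (writeNat asE2 base ((x + sh w y) % M)) y') := by
        rw [Finset.smul_sum]
        simp_rw [Finset.smul_sum, smul_smul]
        rw [Finset.sum_comm]
        refine sum_congr rfl fun y' _ => ?_
        rw [Finset.sum_comm]
        refine sum_congr rfl fun y _ => sum_congr rfl fun x _ => ?_
        congr 1; ring
    _ = (invSqrt2 ^ k * invSqrt2 ^ k) • ∑ y' : Fin k → Bool, ∑ y : Fin k → Bool, (sPhase σ y * ySign y y' * e (((u * sh w y : ℕ) : ℝ) / M)) •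
          ∑ x ∈ range M, mode M u x • basisState (writeB cw (writeNat asE2 base x) y') := by
        congr 1
        refine sum_congr rfl fun y' _ => sum_congr rfl fun y _ => ?_
        rw [sum_range_mode_smul_comp_shift hM u (sh w y) (fun x => basisState (writeB cw (writeNat asE2 base x) y')),
          smul_smul]
    _ = ∑ x ∈ range M, mode M u x • ∑ γ : Fin k → Bool, modeAmp σ w M u γ •
          basisState (writeB cw (writeNat asE2 base x) γ) := by
        rw [Finset.smul_sum]
        -- both sides as a sum over `(γ, x)`
        have hR : ∑ x ∈ range M, mode M u x • ∑ γ : Fin k → Bool, modeAmp σ w M u γ •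
            basisState (writeB cw (writeNat asE2 base x) γ) =
            ∑ γ : Fin k → Bool, ∑ x ∈ range M, (modeAmp σ w M u γ * mode M u x) •
              basisState (writeB cw (writeNat asE2 base x) γ) := by
          simp_rw [Finset.smul_sum, smul_smul]
          rw [Finset.sum_comm]
          refine sum_congr rfl fun γ _ => sum_congr rfl fun x _ => ?_
          rw [mul_comm]
        rw [hR]
        refine sum_congr rfl fun γ _ => ?_
        rw [modeAmp_eq, ← invSqrt2_pow_mul_pow, Finset.smul_sum]
        simp_rw [Finset.smul_sum, smul_smul]
        rw [Finset.sum_comm]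
        refine sum_congr rfl fun x _ => ?_
        rw [← Finset.sum_smul]
        congr 1
        rw [Finset.mul_sum, Finset.sum_mul]
        refine sum_congr rfl fun y _ => ?_
        ring

end KitaevShift

end Literature.Computability.Cryptography

end
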